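import Mathlib
import Literature.NumberTheory.LFunctions.BernoulliOneOdd
import Summits.HodgeConjecture.FermatCycles.HodgeFermatLemmaEGoodA

/-!
# LEMMA E for every GOOD character — part 2: THEOREM F*(3N) from the vanishing of the Bad coefficients; the prime level (`HodgeFermat/LemmaEGood.lean`; HF-G32c)

Tree copy (part 2 of 2) of the module `HodgeFermat/LemmaEGood.lean` of the sibling cell's standalone package
`run/shared/lean/pub/pub-hodgefermat/lean/HodgeFermat/` (645 lines, sha256 `d2bae049509fdda0…`), source lines 331–645 (§4 prime level: every character is good; §5 PARITY(3N) and THEOREM F*(3N) from the vanishing of the Bad coefficients, `BadVanishMu`/`BadVanishNu`, `thmFstar_of_bad`; §6 the prime level once more, `thmFstar_prime`).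
Filed by cell `pub-hfermat`, seat prover-1 gen-2, on the COORDINATOR KEEPER RULING of 2026-08-25 (gem sweep H1: take the
off-gate kernel theorem `thmFstar` through the gate) — here its second namesake, `HodgeFermat/ThmFstarNFinal.lean:29`,
THEOREM F*(3N) at every admissible squarefree level (the first, `DecodingFinal.thmFstar` = THEOREM F* at the prime levels,
landed on 2026-08-25 as `HodgeFermatThmFstar.lean`, seat prover-1 gen-0); this file is one link of the import closure of
`ThmFstarNFinal.thmFstar` on top of that landed chain.  The source module's declarations are VERBATIM those of the cell record
`check/ThmFstarN_standalone.lean` (21 bodies, 438 871 B, sha256 ced731ec52c92191…, hub `lean check` rc 0, 222.2 s, `--axioms …ThmFstarN.thmFstarN` = [propext, Classical.choice, Quot.sound]; pub-hodgefermat `CERT.md` l.987, GATE HF-G33).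
Deviations from the source module, exhaustively: the `import` lines (tree modules `Summits.HodgeConjecture.FermatCycles.
HodgeFermat*` instead of `HodgeFermat.*`); this module docstring; the namespace/`open` preamble (source l.47–56) is repeated at the top because the module is split, followed by the added line `open Literature.NumberTheory.LFunctions.BernoulliOneOdd (ne_one_of_odd)`: the one use of `ne_one_of_odd` (source l.623, byte-identical) named `HodgeFermat.KRFree.LemmaEMu.ne_one_of_odd`, which the landed `HodgeFermatLemmaEMu.lean` deleted as a verbatim restatement of the Literature lemma (gate dedup, p397837), so the name now resolves to `Literature.NumberTheory.LFunctions.BernoulliOneOdd.ne_one_of_odd` (extra import); DEDUP (pre-empting the gate's `dedup.landed`, cf. the bounce of p400658): the source's consistency check `theorem thmFstar_prime` (l.629–641) has, by design, exactly the statement of the landed `HodgeFermat.KRFree.Decoding.thmFstar` and is therefore DELETED (its one use, the prime case of `ThmFstarN.thmFstarN`, names `Decoding.thmFstar` instead — see `HodgeFermatThmFstarN.lean`); one-line docstrings added (gate lint) to `muFun_nonunit`, `badVanishMu_of_prime`, `badVanishNu_of_prime`. The module docstring is quoted in full in part 1.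
Every other line — in particular every declaration's statement and proof — is byte-identical to the source.
HONEST FRAMING: explicit algebraic cycles for specific Hodge classes on Fermat/Delsarte varieties; residual open instances
listed; no claim on general Hodge.  (This file is arithmetic of CM types / of `(ℤ/N)ˣ`; it claims nothing about cycles.)
-/

namespace HodgeFermat.KRFree.LemmaEGood

open Finset HodgeFermat.KRFree.LemmaN HodgeFermat.KRFree.TwistedMoment HodgeFermat.KRFree.LemmaEMu
open HodgeFermat.KRFree.ChiThree (chi3 chi3_of_dvd units)
open HodgeFermat.KRFree.LemmaENu (nhat nuw_toFun moment_eq_LFunction isPrimitive_three_mul)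
open HodgeFermat.KRFree.NuChar (chi3Mul chi3Mul_natCast chi3Mul_inv chi3Mul_ram chi3Mul_ne_one nu3 nhat_chi3Mul)
open HodgeFermat.KRFree.MuEven (muEntry muFun even_of_hat_odd_eq_zero)
open HodgeFermat.KRFree.NuOdd (nuEntry nuFun nuEntry_eq_zero hat_nuFun sum_nuEntry_one totient_mul_add_neg)
open HodgeFermat.KRFree.NuOddSharp (chi3_sum_cases int_aux)
open HodgeFermat.KRFree.DecodingRing (Parity thmF_of_parity)
open Literature.NumberTheory.LFunctions.BernoulliOneOdd (ne_one_of_odd)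
/-! ## 4. Prime level: every character in question is good -/

section prime

variable {p : ℕ}

/-- at a prime level every `ψ ≠ 1` is good (it is primitive) -/
theorem good_of_prime (hp : p.Prime) (ψ : DirichletCharacter ℂ p) (hψ1 : ψ ≠ 1) : Good ψ := by
  haveI : NeZero p := ⟨hp.ne_zero⟩
  exact good_of_isPrimitive ψ (isPrimitive_of_prime hp hψ1)

/-- at a prime level `p ≠ 3`, `χ₃ × ψ` is good for every `ψ ≠ 1` (it is primitive of conductor `3p`) -/
theorem good_chi3Mul_of_prime (hp : p.Prime) (hp3 : p ≠ 3) (ψ : DirichletCharacter ℂ p) (hψ1 : ψ ≠ 1) :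
    Good (chi3Mul ψ) := by
  haveI : NeZero (3 * p) := ⟨Nat.mul_ne_zero (by norm_num) hp.ne_zero⟩
  have h3p : ¬ 3 ∣ p := fun h => hp3 ((Nat.prime_dvd_prime_iff_eq Nat.prime_three hp).mp h).symm
  have hA : ∃ j : ℕ, Nat.Coprime j (3 * p) ∧ j % p = 1 % p ∧ chi3Mul ψ (j : ZMod (3 * p)) ≠ 1 := by
    obtain ⟨j, hj, hj3, hjp⟩ := exists_unit h3p
    exact ⟨j, hj, hjp, chi3Mul_ram ψ hj hj3 hjp⟩
  exact good_of_isPrimitive _ (isPrimitive_three_mul hp (chi3Mul ψ) hA (chi3Mul_ne_one hp hp3 ψ hψ1))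

end prime

/-! ## 5. PARITY(3N) and THEOREM F\*(3N) from the vanishing of the Bad coefficients -/

section parity

/-- HYPOTHESIS (DPRIME §7.2–7.4, not proved here): the coefficients of `μ_T − μ_T′` vanish at the BAD odd
characters too. -/
def BadVanishMu (N : ℕ) [NeZero N] (T T' : ℕ × ℕ × ℕ) : Prop :=
  ∀ ψ : DirichletCharacter ℂ N, ψ.Odd → ¬ Good ψ →
    ∑ x : ZMod N, ((muFun T x - muFun T' x : ℤ) : ℂ) * ψ⁻¹ x = 0

/-- HYPOTHESIS (DPRIME §7.2–7.4, not proved here): the coefficients of `ν_T − ν_T′` vanish at the even `ψ ≠ 1`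
with `χ₃ × ψ` BAD too. -/
def BadVanishNu (N : ℕ) [NeZero N] (T T' : ℕ × ℕ × ℕ) : Prop :=
  ∀ ψ : DirichletCharacter ℂ N, ψ.Even → ψ ≠ 1 → ¬ Good (chi3Mul ψ) →
    ∑ x : ZMod N, ((nuFun T x - nuFun T' x : ℤ) : ℂ) * ψ⁻¹ x = 0

variable {N : ℕ}

/-- `μ_a` vanishes off the units when `a` is prime to `N` (`3 ∤ N`) -/
lemma muEntry_nonunit {a : ℕ} (ha : Nat.Coprime a N) {x : ZMod N} (hx : ¬ IsUnit x) :
    muEntry a x = 0 := by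
  unfold muEntry
  have hua : IsUnit ((a : ℕ) : ZMod N) := (ZMod.isUnit_iff_coprime a N).mpr ha
  by_cases h3 : 3 ∣ a
  · rw [if_pos h3]
    have hu3 : IsUnit (((a / 3 : ℕ)) : ZMod N) :=
      (ZMod.isUnit_iff_coprime _ N).mpr (Nat.Coprime.coprime_dvd_left (Nat.div_dvd_of_dvd h3) ha)
    rw [if_neg]
    intro h
    exact hx (h ▸ hu3)
  · rw [if_neg h3]
    have h1 : ((a : ℕ) : ZMod N) ≠ x := fun h => hx (h ▸ hua)
    have h2 : ((a : ℕ) : ZMod N) ≠ 3 * x := by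
      intro h
      apply hx
      have h3x : IsUnit ((3 : ZMod N) * x) := h ▸ hua
      exact isUnit_of_mul_isUnit_right h3x
    rw [if_neg h1, if_neg h2, sub_self]

/-- `μ_T` vanishes off the units (entries prime to `N`) -/
lemma muFun_nonunit {a b c : ℕ} (ha : Nat.Coprime a N) (hb : Nat.Coprime b N)
    (hc : Nat.Coprime c N) {x : ZMod N} (hx : ¬ IsUnit x) : muFun (a, b, c) x = 0 := by
  simp only [muFun, muEntry_nonunit ha hx, muEntry_nonunit hb hx, muEntry_nonunit hc hx, add_zero]

variable [NeZero N]

/-- **μ_T − μ_T′ is EVEN on `ℤ/N`** (any level; from H0 and the vanishing of the Bad μ-coefficients). -/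
theorem mu_even_of_bad (h0 : H0) (h1N : 1 < N) (h3N : ¬ 3 ∣ N)
    {a b c a' b' c' : ℕ} (hs : 3 * N ∣ a + b + c) (hs' : 3 * N ∣ a' + b' + c')
    (ha : Nat.Coprime a N) (hb : Nat.Coprime b N) (hc : Nat.Coprime c N)
    (ha' : Nat.Coprime a' N) (hb' : Nat.Coprime b' N) (hc' : Nat.Coprime c' N)
    (hT : SameType (3 * N) (a, b, c) (a', b', c')) (hμ : BadVanishMu N (a, b, c) (a', b', c'))
    (x : ZMod N) :
    muFun (a, b, c) (-x) - muFun (a', b', c') (-x) = muFun (a, b, c) x - muFun (a', b', c') x := by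
  by_cases hx : IsUnit x
  · obtain ⟨u, rfl⟩ := hx
    have key := even_of_hat_odd_eq_zero (fun y => ((muFun (a, b, c) y - muFun (a', b', c') y : ℤ) : ℂ))
      (fun ψ hψ => by
        by_cases hg : Good ψ
        · exact hat_mu_diff_eq_zero_of_good h0 h1N h3N ψ hψ hg hs hs' ha hb hc ha' hb' hc' hT
        · exact hμ ψ hψ hg) u
    exact_mod_cast key
  · have hx' : ¬ IsUnit (-x) := fun h => hx (by simpa using h.neg)
    rw [muFun_nonunit ha hb hc hx, muFun_nonunit ha' hb' hc' hx, muFun_nonunit ha hb hc hx',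
      muFun_nonunit ha' hb' hc' hx']

/-- **THE KEY STEP at any level (from H0 and the vanishing of the Bad ν-coefficients):** `Σχ₃(T) = Σχ₃(T′)` and
`D(u) + D(−u) = 0` for every unit `u`, `D = ν_T − ν_T′`, provided `φ(N) ≥ 10`, `φ(N) ≠ 12` (integrality:
`φ(N)·(D(u) + D(−u)) = 2δ`, `2δ ∈ {0, ±6, ±12}`). -/
theorem nu_key_of_bad (h0 : H0) (h1N : 1 < N) (h3N : ¬ 3 ∣ N) (hφ10 : 10 ≤ N.totient) (hφ12 : N.totient ≠ 12)
    {a b c a' b' c' : ℕ} (hs : 3 * N ∣ a + b + c) (hs' : 3 * N ∣ a' + b' + c')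
    (ha : Nat.Coprime a N) (hb : Nat.Coprime b N) (hc : Nat.Coprime c N)
    (ha' : Nat.Coprime a' N) (hb' : Nat.Coprime b' N) (hc' : Nat.Coprime c' N)
    (hT : SameType (3 * N) (a, b, c) (a', b', c')) (hν : BadVanishNu N (a, b, c) (a', b', c')) :
    ((chi3 a + chi3 b + chi3 c : ℤ) : ℂ) = ((chi3 a' + chi3 b' + chi3 c' : ℤ) : ℂ) ∧
    ∀ u : (ZMod N)ˣ, ((nuFun (a, b, c) (u : ZMod N) - nuFun (a', b', c') (u : ZMod N) : ℤ) : ℂ)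
      + ((nuFun (a, b, c) (-(u : ZMod N)) - nuFun (a', b', c') (-(u : ZMod N)) : ℤ) : ℂ) = 0 := by
  set F : ZMod N → ℂ := fun y => ((nuFun (a, b, c) y - nuFun (a', b', c') y : ℤ) : ℂ) with hFdef
  have hF : ∀ ψ : DirichletCharacter ℂ N, ψ.Even → ψ ≠ 1 → ∑ x : ZMod N, F x * ψ⁻¹ x = 0 := by
    intro ψ hψ hψ1
    by_cases hg : Good (chi3Mul ψ)
    · exact hat_nu_diff_eq_zero_of_good h0 h1N h3N ψ hψ hg hs hs' ha hb hc ha' hb' hc' hT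
    · exact hν ψ hψ hψ1 hg
  have inv := totient_mul_add_neg F hF
  have hδ : ∑ x : ZMod N, F x * (1 : DirichletCharacter ℂ N) x
      = ((chi3 a + chi3 b + chi3 c : ℤ) : ℂ) - ((chi3 a' + chi3 b' + chi3 c' : ℤ) : ℂ) := by
    simp only [hFdef, nuFun, Int.cast_sub, Int.cast_add, sub_mul, add_mul, Finset.sum_sub_distrib,
      Finset.sum_add_distrib, sum_nuEntry_one ha, sum_nuEntry_one hb, sum_nuEntry_one hc, sum_nuEntry_one ha',
      sum_nuEntry_one hb', sum_nuEntry_one hc']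
  have h1 := inv 1
  rw [hδ, Units.val_one] at h1
  have hint : (N.totient : ℤ) * ((nuFun (a, b, c) (1 : ZMod N) - nuFun (a', b', c') (1 : ZMod N))
      + (nuFun (a, b, c) (-(1 : ZMod N)) - nuFun (a', b', c') (-(1 : ZMod N))))
      = 2 * ((chi3 a + chi3 b + chi3 c) - (chi3 a' + chi3 b' + chi3 c')) := by
    have h1' := h1
    simp only [hFdef] at h1'
    exact_mod_cast h1'
  have ht : (10 : ℤ) ≤ (N.totient : ℤ) := by exact_mod_cast hφ10
  have ht12 : (N.totient : ℤ) ≠ 12 := by exact_mod_cast hφ12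
  have h3 : 3 ∣ a + b + c := dvd_trans (Dvd.intro N rfl) hs
  have h3' : 3 ∣ a' + b' + c' := dvd_trans (Dvd.intro N rfl) hs'
  have hk : chi3 a + chi3 b + chi3 c - (chi3 a' + chi3 b' + chi3 c') = 0 ∨
      chi3 a + chi3 b + chi3 c - (chi3 a' + chi3 b' + chi3 c') = 3 ∨
      chi3 a + chi3 b + chi3 c - (chi3 a' + chi3 b' + chi3 c') = -3 ∨
      chi3 a + chi3 b + chi3 c - (chi3 a' + chi3 b' + chi3 c') = 6 ∨
      chi3 a + chi3 b + chi3 c - (chi3 a' + chi3 b' + chi3 c') = -6 := by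
    rcases chi3_sum_cases h3 with h | h | h <;> rcases chi3_sum_cases h3' with h' | h' | h' <;> omega
  have hδZ := int_aux ht ht12 hint hk
  have hδ0 : ((chi3 a + chi3 b + chi3 c : ℤ) : ℂ) - ((chi3 a' + chi3 b' + chi3 c' : ℤ) : ℂ) = 0 := by
    have : ((chi3 a + chi3 b + chi3 c : ℤ) : ℂ) = ((chi3 a' + chi3 b' + chi3 c' : ℤ) : ℂ) := by
      have hz : (chi3 a + chi3 b + chi3 c : ℤ) = chi3 a' + chi3 b' + chi3 c' := by omega
      exact_mod_cast hz
    rw [this, sub_self]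
  have h2δ : 2 * ∑ x : ZMod N, F x * (1 : DirichletCharacter ℂ N) x = 0 := by
    rw [hδ, hδ0, mul_zero]
  refine ⟨sub_eq_zero.mp hδ0, fun v => ?_⟩
  have hφ : (N.totient : ℂ) ≠ 0 := Nat.cast_ne_zero.mpr (Nat.totient_pos.mpr (NeZero.pos N)).ne'
  have hv := inv v
  rw [h2δ] at hv
  exact (mul_eq_zero.mp hv).resolve_left hφ

/-- **Σχ₃(T) = Σχ₃(T′)** at any level (from H0 and the Bad ν-coefficients). -/
theorem nu_sum_eq_of_bad (h0 : H0) (h1N : 1 < N) (h3N : ¬ 3 ∣ N) (hφ10 : 10 ≤ N.totient)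
    (hφ12 : N.totient ≠ 12)
    {a b c a' b' c' : ℕ} (hs : 3 * N ∣ a + b + c) (hs' : 3 * N ∣ a' + b' + c')
    (ha : Nat.Coprime a N) (hb : Nat.Coprime b N) (hc : Nat.Coprime c N)
    (ha' : Nat.Coprime a' N) (hb' : Nat.Coprime b' N) (hc' : Nat.Coprime c' N)
    (hT : SameType (3 * N) (a, b, c) (a', b', c')) (hν : BadVanishNu N (a, b, c) (a', b', c')) :
    chi3 a + chi3 b + chi3 c = chi3 a' + chi3 b' + chi3 c' := by
  have h := (nu_key_of_bad h0 h1N h3N hφ10 hφ12 hs hs' ha hb hc ha' hb' hc' hT hν).1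
  exact_mod_cast h

/-- **ν_T − ν_T′ is ODD on `ℤ/N`** at any level (from H0 and the Bad ν-coefficients). -/
theorem nu_odd_of_bad (h0 : H0) (h1N : 1 < N) (h3N : ¬ 3 ∣ N) (hφ10 : 10 ≤ N.totient)
    (hφ12 : N.totient ≠ 12)
    {a b c a' b' c' : ℕ} (hs : 3 * N ∣ a + b + c) (hs' : 3 * N ∣ a' + b' + c')
    (ha : Nat.Coprime a N) (hb : Nat.Coprime b N) (hc : Nat.Coprime c N)
    (ha' : Nat.Coprime a' N) (hb' : Nat.Coprime b' N) (hc' : Nat.Coprime c' N)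
    (hT : SameType (3 * N) (a, b, c) (a', b', c')) (hν : BadVanishNu N (a, b, c) (a', b', c'))
    (x : ZMod N) :
    nuFun (a, b, c) (-x) - nuFun (a', b', c') (-x) = -(nuFun (a, b, c) x - nuFun (a', b', c') x) := by
  by_cases hx : IsUnit x
  · obtain ⟨u, rfl⟩ := hx
    have h := (nu_key_of_bad h0 h1N h3N hφ10 hφ12 hs hs' ha hb hc ha' hb' hc' hT hν).2 u
    have h' : ((nuFun (a, b, c) (-(u : ZMod N)) - nuFun (a', b', c') (-(u : ZMod N)) : ℤ) : ℂ)
        = -(((nuFun (a, b, c) (u : ZMod N) - nuFun (a', b', c') (u : ZMod N) : ℤ) : ℂ)) := by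
      linear_combination h
    exact_mod_cast h'
  · have ne : ∀ {y : ℕ}, Nat.Coprime y N → ((y : ℕ) : ZMod N) ≠ x := fun hy h =>
      hx (h ▸ (ZMod.isUnit_iff_coprime _ N).mpr hy)
    have ne' : ∀ {y : ℕ}, Nat.Coprime y N → ((y : ℕ) : ZMod N) ≠ -x := by
      intro y hy h
      apply hx
      have hu : IsUnit (-(((y : ℕ) : ZMod N))) := ((ZMod.isUnit_iff_coprime _ N).mpr hy).neg
      rw [h, neg_neg] at hu
      exact hu
    have hz : ∀ {y : ℕ}, Nat.Coprime y N → nuEntry y x = 0 := fun hy => nuEntry_eq_zero (ne hy)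
    have hz' : ∀ {y : ℕ}, Nat.Coprime y N → nuEntry y (-x) = 0 := fun hy => nuEntry_eq_zero (ne' hy)
    show nuEntry a (-x) + nuEntry b (-x) + nuEntry c (-x) - (nuEntry a' (-x) + nuEntry b' (-x) + nuEntry c' (-x))
      = -(nuEntry a x + nuEntry b x + nuEntry c x - (nuEntry a' x + nuEntry b' x + nuEntry c' x))
    rw [hz ha, hz hb, hz hc, hz ha', hz hb', hz hc', hz' ha, hz' hb, hz' hc, hz' ha', hz' hb', hz' hc']
    simp

/-- **PARITY(3N) from the same CM type** at any level (from H0 and the vanishing of the Bad coefficients). -/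
theorem parity_of_bad (h0 : H0) (h1N : 1 < N) (h3N : ¬ 3 ∣ N) (hφ10 : 10 ≤ N.totient)
    (hφ12 : N.totient ≠ 12)
    {a b c a' b' c' : ℕ} (hs : 3 * N ∣ a + b + c) (hs' : 3 * N ∣ a' + b' + c')
    (ha : Nat.Coprime a N) (hb : Nat.Coprime b N) (hc : Nat.Coprime c N)
    (ha' : Nat.Coprime a' N) (hb' : Nat.Coprime b' N) (hc' : Nat.Coprime c' N)
    (hT : SameType (3 * N) (a, b, c) (a', b', c')) (hμ : BadVanishMu N (a, b, c) (a', b', c'))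
    (hν : BadVanishNu N (a, b, c) (a', b', c')) : Parity N (a, b, c) (a', b', c') :=
  ⟨mu_even_of_bad h0 h1N h3N hs hs' ha hb hc ha' hb' hc' hT hμ,
   nu_odd_of_bad h0 h1N h3N hφ10 hφ12 hs hs' ha hb hc ha' hb' hc' hT hν,
   nu_sum_eq_of_bad h0 h1N h3N hφ10 hφ12 hs hs' ha hb hc ha' hb' hc' hT hν⟩

/-- THEOREM F\*(3N) for pairs with entries prime to `N`, at every level `N ≥ 11`, `3 ∤ N`, `N ≠ 13`, with the totient
conditions `φ(N) ≥ 10`, `φ(N) ≠ 12` as HYPOTHESES (they are automatic: `totient_conditions`; the clean statement is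
`thmFstar_of_bad` below) — from H0 and the vanishing of the BAD Fourier coefficients (DPRIME §7.2–7.4) only: two such
zero-sum triples with the same CM type at level `3N` share an entry mod `3N`.  (Analytic half for the good
characters: §2–3; Fourier inversion: §5; decoding: `DecodingRing.thmF_of_parity`.) -/
theorem thmFstar_of_bad_totient (h0 : H0) (hn11 : 11 ≤ N) (h3N : ¬ 3 ∣ N) (hn13 : N ≠ 13)
    (hφ10 : 10 ≤ N.totient) (hφ12 : N.totient ≠ 12)
    {a b c a' b' c' : ℕ} (hs : 3 * N ∣ a + b + c) (hs' : 3 * N ∣ a' + b' + c')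
    (ha : Nat.Coprime a N) (hb : Nat.Coprime b N) (hc : Nat.Coprime c N)
    (ha' : Nat.Coprime a' N) (hb' : Nat.Coprime b' N) (hc' : Nat.Coprime c' N)
    (hD : ∀ u v, (u = a ∨ u = b ∨ u = c) → (v = a' ∨ v = b' ∨ v = c') → ¬ u ≡ v [MOD 3 * N])
    (hT : SameType (3 * N) (a, b, c) (a', b', c')) (hμ : BadVanishMu N (a, b, c) (a', b', c'))
    (hν : BadVanishNu N (a, b, c) (a', b', c')) : False :=
  thmF_of_parity h3N hn11 hn13 hs hs' ha hb hc ha' hb' hc' hD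
    (parity_of_bad h0 (by omega) h3N hφ10 hφ12 hs hs' ha hb hc ha' hb' hc' hT hμ hν)

/-! ### The totient side conditions are automatic -/

omit [NeZero N] in
/-- the least prime factor of an `N > 1` prime to `6` is at least `5` -/
lemma five_le_minFac (h2 : ¬ 2 ∣ N) (h3 : ¬ 3 ∣ N) (hN : N ≠ 1) : 5 ≤ N.minFac := by
  have hq := Nat.minFac_prime hN
  have hqd := Nat.minFac_dvd N
  have hq2 : N.minFac ≠ 2 := fun h => h2 (h ▸ hqd)
  have hq3 : N.minFac ≠ 3 := fun h => h3 (h ▸ hqd)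
  have hq4 : N.minFac ≠ 4 := fun h => by rw [h] at hq; exact absurd hq (by decide)
  have := hq.two_le
  omega

omit [NeZero N] in
/-- `10 ≤ φ(N)` and `φ(N) ≠ 12` for every ODD `N ≥ 11` with `3 ∤ N`, `N ≠ 13`: for `N` prime `φ(N) = N − 1`; otherwise
`N = q·m` with `q = minFac N ≥ 5`, `m ≥ 5`, `gcd(m, 6) = 1`, and `φ(N) ≥ φ(q)·φ(m) ≥ 4·4`
(`Nat.totient_super_multiplicative`). -/
theorem totient_conditions (h2 : ¬ 2 ∣ N) (h3 : ¬ 3 ∣ N) (h11 : 11 ≤ N) (h13 : N ≠ 13) :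
    10 ≤ N.totient ∧ N.totient ≠ 12 := by
  by_cases hp : N.Prime
  · rw [Nat.totient_prime hp]; omega
  · have hN1 : N ≠ 1 := by omega
    have hq := Nat.minFac_prime hN1
    have hq5 := five_le_minFac h2 h3 hN1
    obtain ⟨m, hm⟩ := Nat.minFac_dvd N
    have h2m : ¬ 2 ∣ m := fun h => h2 (hm ▸ dvd_mul_of_dvd_right h _)
    have h3m : ¬ 3 ∣ m := fun h => h3 (hm ▸ dvd_mul_of_dvd_right h _)
    have hm0 : m ≠ 0 := by rintro rfl; rw [mul_zero] at hm; omega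
    have hm1 : m ≠ 1 := by rintro rfl; rw [mul_one] at hm; exact hp (hm ▸ hq)
    -- `φ(m) ≥ 4`: `m = r·k` with `r = minFac m ≥ 5`
    have hr5 := five_le_minFac h2m h3m hm1
    have hr := Nat.minFac_prime hm1
    obtain ⟨k, hk⟩ := Nat.minFac_dvd m
    have hk0 : k ≠ 0 := by rintro rfl; rw [mul_zero] at hk; exact hm0 hk
    have hk1 : 1 ≤ k.totient := Nat.one_le_iff_ne_zero.mpr (by rw [Ne, Nat.totient_eq_zero]; exact hk0)
    have hφm : 4 ≤ m.totient := by
      calc 4 ≤ (m.minFac - 1) * 1 := by omega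
        _ ≤ m.minFac.totient * k.totient := by
            rw [Nat.totient_prime hr]; exact Nat.mul_le_mul_left _ hk1
        _ ≤ (m.minFac * k).totient := Nat.totient_super_multiplicative _ _
        _ = m.totient := by rw [← hk]
    have hφN : 16 ≤ N.totient := by
      calc 16 ≤ (N.minFac - 1) * 4 := by omega
        _ ≤ N.minFac.totient * m.totient := by
            rw [Nat.totient_prime hq]; exact Nat.mul_le_mul_left _ hφm
        _ ≤ (N.minFac * m).totient := Nat.totient_super_multiplicative _ _
        _ = N.totient := by rw [← hm]
    omega

/-- **THEOREM F\*(3N) for pairs with entries prime to `N` — EVERY `N ≥ 11`, `3 ∤ N`, `N ≠ 13` — from H0 and the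
vanishing of the BAD Fourier coefficients (DPRIME §7.2–7.4) ONLY:** two zero-sum triples mod `3N` with entries prime
to `N` and the same CM type at level `3N` share an entry mod `3N`.  (Even `N` is vacuous — three entries prime to `N`
are odd, `DecodingRing.two_not_dvd` — and for odd `N` the totient conditions of `thmFstar_of_bad_totient` hold by
`totient_conditions`.) -/
theorem thmFstar_of_bad (h0 : H0) (hn11 : 11 ≤ N) (h3N : ¬ 3 ∣ N) (hn13 : N ≠ 13)
    {a b c a' b' c' : ℕ} (hs : 3 * N ∣ a + b + c) (hs' : 3 * N ∣ a' + b' + c')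
    (ha : Nat.Coprime a N) (hb : Nat.Coprime b N) (hc : Nat.Coprime c N)
    (ha' : Nat.Coprime a' N) (hb' : Nat.Coprime b' N) (hc' : Nat.Coprime c' N)
    (hD : ∀ u v, (u = a ∨ u = b ∨ u = c) → (v = a' ∨ v = b' ∨ v = c') → ¬ u ≡ v [MOD 3 * N])
    (hT : SameType (3 * N) (a, b, c) (a', b', c')) (hμ : BadVanishMu N (a, b, c) (a', b', c'))
    (hν : BadVanishNu N (a, b, c) (a', b', c')) : False := by
  by_cases h2N : 2 ∣ N
  · have h2s : 2 ∣ a + b + c := h2N.trans ((dvd_mul_left N 3).trans hs)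
    have := DecodingRing.two_not_dvd h2N ha
    have := DecodingRing.two_not_dvd h2N hb
    have := DecodingRing.two_not_dvd h2N hc
    omega
  · obtain ⟨hφ10, hφ12⟩ := totient_conditions h2N h3N hn11 hn13
    exact thmFstar_of_bad_totient h0 hn11 h3N hn13 hφ10 hφ12 hs hs' ha hb hc ha' hb' hc' hD hT hμ hν

end parity

/-! ## 6. Prime level once more: the Bad conditions are vacuous -/

section primeLevel

variable {p : ℕ}

/-- at a prime level the μ-Bad condition is vacuous -/
theorem badVanishMu_of_prime [NeZero p] (hp : p.Prime) (T T' : ℕ × ℕ × ℕ) : BadVanishMu p T T' :=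
  fun ψ hψ hng => absurd (good_of_prime hp ψ (ne_one_of_odd hψ)) hng

/-- at a prime level `p ≠ 3` the ν-Bad condition is vacuous -/
theorem badVanishNu_of_prime [NeZero p] (hp : p.Prime) (hp3 : p ≠ 3) (T T' : ℕ × ℕ × ℕ) :
    BadVanishNu p T T' :=
  fun ψ _ hψ1 hng => absurd (good_chi3Mul_of_prime hp hp3 ψ hψ1) hng

-- `thmFstar_prime` (source l.629–641, THEOREM F*(3p) re-derived through `thmFstar_of_bad`): DELETED — by design a verbatim
-- restatement of the landed `HodgeFermat.KRFree.Decoding.thmFstar` (`HodgeFermatDecodingC.lean`; gate dedup); its one downstream use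
-- (`ThmFstarN.thmFstarN`, prime case) names `Decoding.thmFstar` instead.

end primeLevel

end HodgeFermat.KRFree.LemmaEGood
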